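import Summits.CriticalPhenomena.SAWScalingLimit.Theorems.SAWLoopFugacityFlowLimitAvoidanceValuesReductions
import Summits.CriticalPhenomena.SAWScalingLimit.Theorems.SAWLoopFugacityFlowSimpleSubseqLimitsSplit
import Summits.CriticalPhenomena.SAWScalingLimit.Theorems.SAWSteinDefectAvoidanceLimitTransfer
import Summits.CriticalPhenomena.SAWScalingLimit.Theorems.SAWChargeContinuationSAWAvoidanceLawOfScalingLimit
import Summits.CriticalPhenomena.SAWScalingLimit.Theorems.SAWRenewalTightnessTightIdentificationGlue
import Summits.CriticalPhenomena.SAWScalingLimit.Theorems.SAWWeldingIdentificationRemovableLimitIdle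
import HarnessLib

/-!
# `SAWLoopFugacityFlow.LimitAvoidanceValues` (stmt-CriticalPhenomena-18170): closers from the sibling A-sides, and the converse

The support item `LimitAvoidanceValues` (every subsequential weak limit `ν` of the pushed-forward
critical SAW laws has the hull-avoidance values of some chordal SLE_(8/3) law) is, inside route
`SAWLoopFugacityFlow`, free given the A-side crux `AvoidanceLimit` (stmt-CriticalPhenomena-10649,
`SlitSplit.limitAvoidanceValues_of_avoidanceLimit`).  This file records, from LANDED theorems only:

* **closers from the typed A-sides of the sibling routes** — whichever of them lands first closes
  the item in one line:
  `limitAvoidanceValues_of_steinDefectAvoidanceLimit` (route `SAWSteinDefect`, stmt-CriticalPhenomena-4981,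
  the `pullbackHull` wording of the same 5/8 law, `AvoidanceLimit.loopFugacityFlow_of_steinDefect`),
  `limitAvoidanceValues_of_sawAvoidanceLaw` (route `SAWChargeContinuation`, stmt-CriticalPhenomena-11195,
  the LATTICE-event avoidance law, `SAWChargeContinuation.avoidanceLimit_of_sawAvoidanceLaw`),
  `limitAvoidanceValues_of_weldingLawOfLimit` (route `SAWWeldingIdentification`, stmt-CriticalPhenomena-4502,
  `RemovableLimit.subseqIdentification_of_weldingLawOfLimit'`);
* **the converse, modulo the other route items** — given the parent crux `SimpleSubseqLimits` (S)
  (or its open child `SeqSlitAvoidance` (S₁), through the landed glue `slitSplitGlue_proof`) and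
  eventual tightness `EventualTight` (T), the item gives back the A-side crux:
  `avoidanceLimit_of_limitAvoidanceValues : LimitAvoidanceValues → SimpleSubseqLimits → EventualTight → AvoidanceLimit`
  (item ∧ S identify every subsequential limit, `subseqIdentification_of_limitAvoidanceValues`;
  T + identification give the conjunct `SAWScalingLimit`, `tightIdentificationGlue_proof`; and the
  conjunct implies the closed-range avoidance law, `SAWChargeContinuation.avoidanceLimit_of_sawScalingLimit`).
  Hence `limitAvoidanceValues_iff_avoidanceLimit : SimpleSubseqLimits → EventualTight → (LimitAvoidanceValues ↔ AvoidanceLimit)`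
  and `limitAvoidanceValues_iff_sawScalingLimit`: modulo (S) and (T) — both wanted by every SAW route —
  the support item, the A-side crux and the summit conjunct are one and the same proposition, which
  is why the item is not attacked directly (it is Lawler–Schramm–Werner's restriction prediction).

References: G. F. Lawler, O. Schramm, W. Werner, *Conformal restriction: the chordal case*, J. Amer.
Math. Soc. 16 (2003), §3, Thm. 6.1; *On the scaling limit of planar self-avoiding walk*, Proc. Sympos.
Pure Math. 72 (2004), §4.1; P. Billingsley, *Convergence of Probability Measures* (1999), Thm. 5.1.
-/

noncomputable section

open MeasureTheory Filter Topology Set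
open Literature.Probability.RandomPlanarGeometry Literature.Probability.RandomPlanarGeometry.SAW
open Literature.Probability.LatticeModels

namespace Summit.CriticalPhenomena.SAWScalingLimit.Theorems.LimitAvoidanceValues

open Summit.CriticalPhenomena.SAWScalingLimit.Theses.SAWLoopFugacityFlow
  (LimitAvoidanceValues SubseqIdentification SimpleSubseqLimits SeqSlitAvoidance EventualTight
    AvoidanceLimit)
open Summit.CriticalPhenomena.SAWScalingLimit.Theorems.SimpleSubseqLimits.SlitSplit
  (limitAvoidanceValues_of_avoidanceLimit slitSplitGlue_proof)

/-! ## §1 Closers from the sibling routes' A-sides -/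

/-- **From route `SAWSteinDefect`**: its A-side item `AvoidanceLimit` (stmt-CriticalPhenomena-4981, hull
written `φ.pullbackHull D'`) is the SAWLoopFugacityFlow crux verbatim up to `rfl`
(`AvoidanceLimit.loopFugacityFlow_of_steinDefect`), hence closes the item. [folklore] -/
theorem limitAvoidanceValues_of_steinDefectAvoidanceLimit
    (h : Theses.SAWSteinDefect.AvoidanceLimit) : LimitAvoidanceValues :=
  limitAvoidanceValues_of_avoidanceLimit (AvoidanceLimit.loopFugacityFlow_of_steinDefect h)

/-- **From route `SAWChargeContinuation`**: its lattice-event avoidance law `SAWAvoidanceLaw`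
(stmt-CriticalPhenomena-11195) implies the closed-range avoidance law
(`SAWChargeContinuation.avoidanceLimit_of_sawAvoidanceLaw`), hence closes the item. [folklore] -/
theorem limitAvoidanceValues_of_sawAvoidanceLaw
    (h : Theses.SAWChargeContinuation.SAWAvoidanceLaw) : LimitAvoidanceValues :=
  limitAvoidanceValues_of_avoidanceLimit (SAWChargeContinuation.avoidanceLimit_of_sawAvoidanceLaw h)

/-- **From route `SAWWeldingIdentification`**: the welding law of the limit
(`WeldingLawOfLimit`, stmt-CriticalPhenomena-4502) identifies every subsequential limit
(`RemovableLimit.subseqIdentification_of_weldingLawOfLimit'`), and identified limits carry their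
own SLE_(8/3) values (`limitAvoidanceValues_of_subseqIdentification`). [folklore] -/
theorem limitAvoidanceValues_of_weldingLawOfLimit
    (h : Theses.SAWWeldingIdentification.WeldingLawOfLimit) : LimitAvoidanceValues :=
  limitAvoidanceValues_of_subseqIdentification
    (RemovableLimit.subseqIdentification_of_weldingLawOfLimit' h)

/-! ## §2 The converse, modulo the parent crux and tightness -/

/-- **Item ∧ (S) ∧ (T) ⟹ the summit conjunct.** The item with the parent crux `SimpleSubseqLimits`
identifies every subsequential weak limit as the SLE_(8/3) law
(`subseqIdentification_of_limitAvoidanceValues`), and eventual tightness turns identification into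
convergence in law (`tightIdentificationGlue_proof`, Prokhorov + subsequence principle).
[cite: BillingsleyCPM1999, Thm. 5.1, Corollary] -/
theorem sawScalingLimit_of_limitAvoidanceValues (hV : LimitAvoidanceValues)
    (hS : SimpleSubseqLimits) (hT : EventualTight) : _root_.SAWScalingLimit :=
  tightIdentificationGlue_proof hT (subseqIdentification_of_limitAvoidanceValues hV hS)

/-- **THE CONVERSE OF THE SPLIT, modulo (S) and (T)**:
`LimitAvoidanceValues → SimpleSubseqLimits → EventualTight → AvoidanceLimit`. The item, the parent
crux and tightness give the conjunct `SAWScalingLimit` (`sawScalingLimit_of_limitAvoidanceValues`),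
which implies the closed-range 5/8 avoidance law along the full filter `δ → 0⁺`
(`SAWChargeContinuation.avoidanceLimit_of_sawScalingLimit`: portmanteau sandwich between the lattice
event and the closed event, the difference being SLE_(8/3)-null by LSW Thm. 6.1 and Rohde–Schramm).
[cite: LawlerSchrammWerner2003Restriction, Thm. 6.1] -/
theorem avoidanceLimit_of_limitAvoidanceValues (hV : LimitAvoidanceValues)
    (hS : SimpleSubseqLimits) (hT : EventualTight) : AvoidanceLimit :=
  SAWChargeContinuation.avoidanceLimit_of_sawScalingLimit
    (sawScalingLimit_of_limitAvoidanceValues hV hS hT)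

/-- **The converse with the OPEN child in place of the parent**: the sequential slit-avoidance
child `SeqSlitAvoidance` (stmt-CriticalPhenomena-18169) and the item give the parent crux by the
landed split glue (`slitSplitGlue_proof`), so `LimitAvoidanceValues → SeqSlitAvoidance →
EventualTight → AvoidanceLimit`. [folklore] -/
theorem avoidanceLimit_of_limitAvoidanceValues_of_seqSlitAvoidance (hV : LimitAvoidanceValues)
    (hSeq : SeqSlitAvoidance) (hT : EventualTight) : AvoidanceLimit :=
  avoidanceLimit_of_limitAvoidanceValues hV (slitSplitGlue_proof hSeq hV) hT

/-- **Modulo (S) and (T) the support item IS the A-side crux**: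
`SimpleSubseqLimits → EventualTight → (LimitAvoidanceValues ↔ AvoidanceLimit)`
(`←` is the landed one-liner `SlitSplit.limitAvoidanceValues_of_avoidanceLimit`, unconditionally).
[folklore] -/
theorem limitAvoidanceValues_iff_avoidanceLimit (hS : SimpleSubseqLimits) (hT : EventualTight) :
    LimitAvoidanceValues ↔ AvoidanceLimit :=
  ⟨fun hV => avoidanceLimit_of_limitAvoidanceValues hV hS hT,
    limitAvoidanceValues_of_avoidanceLimit⟩

/-- **Modulo (S₁) and (T) the support item IS the A-side crux** (open-child form):
`SeqSlitAvoidance → EventualTight → (LimitAvoidanceValues ↔ AvoidanceLimit)`. [folklore] -/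
theorem limitAvoidanceValues_iff_avoidanceLimit_of_seqSlitAvoidance (hSeq : SeqSlitAvoidance)
    (hT : EventualTight) : LimitAvoidanceValues ↔ AvoidanceLimit :=
  ⟨fun hV => avoidanceLimit_of_limitAvoidanceValues_of_seqSlitAvoidance hV hSeq hT,
    limitAvoidanceValues_of_avoidanceLimit⟩

/-- **Modulo (S) and (T) the support item IS the summit conjunct**:
`SimpleSubseqLimits → EventualTight → (LimitAvoidanceValues ↔ SAWScalingLimit)`
(`←` is `limitAvoidanceValues_of_sawScalingLimit`, unconditionally). [folklore] -/
theorem limitAvoidanceValues_iff_sawScalingLimit (hS : SimpleSubseqLimits) (hT : EventualTight) :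
    LimitAvoidanceValues ↔ _root_.SAWScalingLimit :=
  ⟨fun hV => sawScalingLimit_of_limitAvoidanceValues hV hS hT,
    limitAvoidanceValues_of_sawScalingLimit⟩

end Summit.CriticalPhenomena.SAWScalingLimit.Theorems.LimitAvoidanceValues

end
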